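import Summits.PneNP.PneNP.Theorems.SymmetryBudgetNoHiddenOrderProgramSrcsB
import Summits.PneNP.PneNP.Theorems.SymmetryBudgetNoHiddenOrderValueAndDefs
import Summits.PneNP.PneNP.Theorems.SymmetryBudgetNoHiddenOrderGraphReadout

/-!
# `NoHiddenOrder` (stmt-PneNP-14781), (R2c) VI: the window canoniser program — kinds and sources of the value shapes

Route `PneNP/SymmetryBudget`; continues `SymmetryBudgetNoHiddenOrderProgramSrcsB.lean`.  Kinds, sources and local levels of the value shapes
of a label `L`: `OrGate` (a `VOr`, reading the CANDIDATE labels' gates through `ofLab ((toLab L).cand y v)`), `AndGate` (a `VAnd`, reading the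
PART labels' gates through `ofLab ((toLab L).part U')`) and `VlGate` (the output gates of a `Value`); the external wires `cdOKW/cdValW/cdOkW/cdBitW`
and `ptOkW/ptBitW`; the root label `rootLabOf` and the window position `wposW` used by the output gates.  Definitions only; supports
stmt-PneNP-14781.
-/

set_option linter.dupNamespace false -- `Summit.PneNP.PneNP.…` (D-0017 single-conjunct layout)

namespace Summit.PneNP.PneNP.Theorems

open Finset CGBits BranchSum Literature.Computability.Complexity Literature.Computability.Complexity.SymProg

namespace WCanon

variable {m : ℕ}

/-! ### External wires: other labels -/

/-- The candidate label `(U, X ∪ {y}, λ[y ↦ v])` of `L` at a FRESH vertex `y ∉ X`, as an admissible label if it is one (`none` otherwise: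
those wires are never read). [folklore] -/
noncomputable def candLab (L : FLab m) (κ : WV m × Fin (wn m)) : Option (FLab m) :=
  if κ.1 ∉ lX L then ofLab ((toLab L).cand κ.1 κ.2) else none

/-- The part label `(U', X, λ)` of `L` at a PART `U' ∈ partSets U`, as an admissible label (`none` at other sets: never read). [folklore] -/
noncomputable def partLab (L : FLab m) (U' : Finset (WV m)) : Option (FLab m) :=
  if U' ∈ partSets (lU L) then ofLab ((toLab L).part U') else none

/-- The last walk stage. -/
abbrev kF (m : ℕ) : Fin (pF m + 1) := Fin.last (pF m)

/-- EXTERNAL wire of candidate `κ`: it decodes. [folklore] -/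
noncomputable def cdOKW (L : FLab m) (κ : WV m × Fin (wn m)) : Wire m :=
  match candLab L κ with
  | some Lc => Sum.inr (.vl Lc .decOK)
  | none => Sum.inr .ff

/-- EXTERNAL wire of candidate `κ`: one-hot colour `c` of `w` in its decoded instance. [folklore] -/
noncomputable def cdValW (L : FLab m) (κ : WV m × Fin (wn m)) (w : WV m) (c : Fin (wn m)) : Wire m :=
  match candLab L κ with
  | some Lc => valW Lc (kF m) w c
  | none => Sum.inr .ff

/-- EXTERNAL wire of candidate `κ`: it has a value. [folklore] -/
noncomputable def cdOkW (L : FLab m) (κ : WV m × Fin (wn m)) : Wire m :=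
  match candLab L κ with
  | some Lc => Sum.inr (.vl Lc .ok)
  | none => Sum.inr .ff

/-- EXTERNAL wire of candidate `κ`: bit `b` of its value. [folklore] -/
noncomputable def cdBitW (L : FLab m) (κ : WV m × Fin (wn m)) (b : Fin (NB (wn m))) : Wire m :=
  match candLab L κ with
  | some Lc => Sum.inr (.vl Lc (.bit b))
  | none => Sum.inr .ff

/-- EXTERNAL wire of part `U'`: it has a value. [folklore] -/
noncomputable def ptOkW (L : FLab m) (U' : Finset (WV m)) : Wire m :=
  match partLab L U' with
  | some Lp => Sum.inr (.vl Lp .ok)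
  | none => Sum.inr .ff

/-- EXTERNAL wire of part `U'`: bit `b` of its value. [folklore] -/
noncomputable def ptBitW (L : FLab m) (U' : Finset (WV m)) (b : Fin (NB (wn m))) : Wire m :=
  match partLab L U' with
  | some Lp => Sum.inr (.vl Lp (.bit b))
  | none => Sum.inr .ff

/-! ### The value shape at an individualisation node -/

/-- The refinement inputs of the candidate vertex `y`: the last state's membership and adjacency, the individualised order and kernel.
[folklore] -/
def orRIIn (L : FLab m) (y : WV m) : RIIn m where
  mem := memW L (kF m)
  adj := adjWire
  lt0 u v := Sum.inr (.vor L (.ltx y u v))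
  eq0 u v := Sum.inr (.vor L (.eqx y u v))

/-- The lifted value wire of bit `b` of candidate `κ` of label `L`. [folklore] -/
noncomputable def orLW (L : FLab m) (κ : WV m × Fin (wn m)) (b : Fin (NB (wn m))) : Wire m :=
  liftWire (fun κ i c => Gt.vor L (.liftC κ i c)) (cdBitW L) κ b

/-- The guard of candidate `κ`: a fresh block vertex with an admissible candidate label. [folklore] -/
def OrGuard (L : FLab m) (κ : WV m × Fin (wn m)) : Prop :=
  κ.1 ∈ lU L ∧ κ.1 ∉ lX L ∧ admW m ((⟨lU L, lX L, lLam L⟩ : CertifiedLabels.Label (WV m)).cand κ.1 κ.2)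

/-- The guard is decidable. -/
instance (L : FLab m) : DecidablePred (OrGuard L) := fun κ =>
  inferInstanceAs (Decidable (κ.1 ∈ lU L ∧ κ.1 ∉ lX L ∧ admW m ((⟨lU L, lX L, lLam L⟩ : CertifiedLabels.Label (WV m)).cand κ.1 κ.2)))

/-- Kinds of the value shape at an individualisation node. [folklore] -/
def orKind (L : FLab m) : OrGate m → Kind
  | .ltx _ _ _ => .or
  | .eqx _ _ _ => .and
  | .rv _ g => riKind g
  | .bothc _ _ _ => .and
  | .nonec _ _ _ => .nor
  | .xnc _ _ _ => .or
  | .eqc _ => .and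
  | .kept κ => if OrGuard L κ then .and else .or
  | .cmu _ _ _ _ => .and
  | .cm _ _ _ => .or
  | .lc _ _ _ _ => .and
  | .liftC _ _ _ => .or
  | .vc g => voKind g
  | .beat _ _ => .and
  | .nbeat _ _ => .nor
  | .best _ => .and
  | .orOk => .or
  | .ob _ _ => .and
  | .orBit _ => .or

/-- Sources of the value shape at an individualisation node of label `L`. [folklore] -/
noncomputable def orSrcs (L : FLab m) : OrGate m → Finset (Wire m)
  | .ltx y u v =>
      if v = y ∧ u ≠ y then {Sum.inr (.an L (kF m) (.oLt u v)), Sum.inr (.an L (kF m) (.oEq u v))}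
      else {Sum.inr (.an L (kF m) (.oLt u v))}
  | .eqx y u v => if (u = y ↔ v = y) then {Sum.inr (.an L (kF m) (.oEq u v))} else {Sum.inr .ff}
  | .rv y g => riSrcs (orRIIn L y) (fun g' => .vor L (.rv y g')) g
  | .bothc κ w c => {cdValW L κ w c, Sum.inr (.vor L (.rv κ.1 (.vval w c)))}
  | .nonec κ w c => {cdValW L κ w c, Sum.inr (.vor L (.rv κ.1 (.vval w c)))}
  | .xnc κ w c => {Sum.inr (.vor L (.bothc κ w c)), Sum.inr (.vor L (.nonec κ w c))}
  | .eqc κ => insert (cdOKW L κ) ((univ : Finset (WV m × Fin (wn m))).image fun wc => Sum.inr (.vor L (.xnc κ wc.1 wc.2)))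
  | .kept κ => if OrGuard L κ then {Sum.inr (.an L (kF m) (.mcSel κ.1)), Sum.inr (.vor L (.eqc κ)), cdOkW L κ} else ∅
  | .cmu y c' c u => {memW L (kF m) u, Sum.inr (.vor L (.rv y (.vval u c'))), valW L (kF m) u c}
  | .cm y c' c => univ.image fun u => Sum.inr (.vor L (.cmu y c' c u))
  | .lc κ i c' c => {cdBitW L κ (cIdx i c'), Sum.inr (.vor L (.cm κ.1 c' c))}
  | .liftC κ i c => univ.image fun c' => Sum.inr (.vor L (.lc κ i c' c))
  | .vc g => voSrcs (orLW L) (fun g' => .vor L (.vc g')) g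
  | .beat κ' κ => {Sum.inr (.vor L (.kept κ')), Sum.inr (.vor L (.vc (.less κ' κ)))}
  | .nbeat κ' κ => {Sum.inr (.vor L (.beat κ' κ))}
  | .best κ => insert (Sum.inr (.vor L (.kept κ))) (univ.image fun κ' => Sum.inr (.vor L (.nbeat κ' κ)))
  | .orOk => univ.image fun κ => Sum.inr (.vor L (.kept κ))
  | .ob κ b => {Sum.inr (.vor L (.best κ)), orLW L κ b}
  | .orBit b => univ.image fun κ => Sum.inr (.vor L (.ob κ b))

/-! ### The value shape at a section node -/

/-- Kinds of the value shape at a section node. [folklore] -/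
def andKind : AndGate m → Kind
  | .nreach _ _ => .nor
  | .partAt _ _ => .and
  | .isPart _ => .or
  | .nisPart _ => .nor
  | .imp _ => .or
  | .andOk => .and
  | .vc g => vaKind g
  | .pg _ U'' u => if u ∈ U'' then .and else .or
  | .cntGe _ t => .atLeast t
  | .ncntGe _ _ => .nor
  | .cntIs _ _ => .and
  | .eqp _ _ => .and
  | .multGe _ q => .atLeast q
  | .rowSrc i _ t => if (t : ℕ) ≤ i then .and else .or
  | .pcb i _ U' t o => if (o : ℕ) = ((i : ℕ) - t) % U'.card then .and else .or
  | .pCol _ _ => .or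
  | .scp i j U' t => if (t : ℕ) ≤ i ∧ (t : ℕ) ≤ j ∧ ((i : ℕ) - t) / U'.card = ((j : ℕ) - t) / U'.card then .and else .or
  | .sameCopy _ _ => .or
  | .nsame _ _ => .nor
  | .pab i j U' t o o' => if (o : ℕ) = ((i : ℕ) - t) % U'.card ∧ (o' : ℕ) = ((j : ℕ) - t) % U'.card then .and else .or
  | .pOwn _ _ => .or
  | .swu _ _ _ _ => .and
  | .swcc _ _ => .or
  | .xcp _ _ _ _ => .and
  | .xc _ _ => .or
  | .pX _ _ => .and
  | .pAdj _ _ => .or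

/-- The reachability wire of the last state of `L`. -/
abbrev reachW (L : FLab m) (u w : WV m) : Wire m := Sum.inr (.an L (kF m) (.rR (Fin.last (wn m)) u w))

/-- Sources of the value shape at a section node of label `L`. [folklore] -/
noncomputable def andSrcs (L : FLab m) : AndGate m → Finset (Wire m)
  | .nreach u w => {reachW L u w}
  | .partAt u U' => U'.image (reachW L u) ∪ (univ \ U').image fun w => Sum.inr (.vand L (.nreach u w))
  | .isPart U' => if U' ∈ partSets (lU L) then U'.image fun u => Sum.inr (.vand L (.partAt u U')) else ∅
  | .nisPart U' => {Sum.inr (.vand L (.isPart U'))}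
  | .imp U' => {Sum.inr (.vand L (.nisPart U')), ptOkW L U'}
  | .andOk => (partSets (lU L)).image fun U' => Sum.inr (.vand L (.imp U'))
  | .vc g => vaSrcs (ptBitW L) (fun g' => .vand L (.vc g')) g
  | .pg U' U'' u => if u ∈ U'' then {Sum.inr (.vand L (.isPart U'')), Sum.inr (.vand L (.vc (.less U'' U')))} else ∅
  | .cntGe U' _ => (partSets (lU L) ×ˢ (univ : Finset (WV m))).image fun Uu => Sum.inr (.vand L (.pg U' Uu.1 Uu.2))
  | .ncntGe U' t => {Sum.inr (.vand L (.cntGe U' t))}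
  | .cntIs U' t => {Sum.inr (.vand L (.cntGe U' t.castSucc)), Sum.inr (.vand L (.ncntGe U' t.succ))}
  | .eqp U' U'' => {Sum.inr (.vand L (.isPart U'')), Sum.inr (.vand L (.vc (.eqall U'' U')))}
  | .multGe U' _ => (partSets (lU L)).image fun U'' => Sum.inr (.vand L (.eqp U' U''))
  | .rowSrc i U' t =>
      if (t : ℕ) ≤ i then
        {Sum.inr (.vand L (.isPart U')), Sum.inr (.vand L (.cntIs U' t)), Sum.inr (.vand L (.multGe U' (qIdx i t U'.card)))}
      else ∅
  | .pcb i c U' t o =>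
      if (o : ℕ) = ((i : ℕ) - t) % U'.card then {Sum.inr (.vand L (.rowSrc i U' t)), ptBitW L U' (cIdx o c)} else ∅
  | .pCol i c =>
      (partSets (lU L) ×ˢ ((univ : Finset (Fin (wn m + 1))) ×ˢ (univ : Finset (Fin (wn m))))).image fun z =>
        Sum.inr (.vand L (.pcb i c z.1 z.2.1 z.2.2))
  | .scp i j U' t =>
      if (t : ℕ) ≤ i ∧ (t : ℕ) ≤ j ∧ ((i : ℕ) - t) / U'.card = ((j : ℕ) - t) / U'.card then
        {Sum.inr (.vand L (.isPart U')), Sum.inr (.vand L (.cntIs U' t)), Sum.inr (.vand L (.multGe U' (qIdx i t U'.card)))}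
      else ∅
  | .sameCopy i j =>
      (partSets (lU L) ×ˢ (univ : Finset (Fin (wn m + 1)))).image fun z => Sum.inr (.vand L (.scp i j z.1 z.2))
  | .nsame i j => {Sum.inr (.vand L (.sameCopy i j))}
  | .pab i j U' t o o' =>
      if (o : ℕ) = ((i : ℕ) - t) % U'.card ∧ (o' : ℕ) = ((j : ℕ) - t) % U'.card then
        {Sum.inr (.vand L (.scp i j U' t)), ptBitW L U' (aIdx o o')}
      else ∅
  | .pOwn i j =>
      (partSets (lU L) ×ˢ ((univ : Finset (Fin (wn m + 1))) ×ˢ ((univ : Finset (Fin (wn m))) ×ˢ (univ : Finset (Fin (wn m)))))).image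
        fun z => Sum.inr (.vand L (.pab i j z.1 z.2.1 z.2.2.1 z.2.2.2))
  | .swu c c' u w =>
      {memW L (kF m) u, memW L (kF m) w, valW L (kF m) u c, valW L (kF m) w c', Sum.inr (.an L (kF m) (.swTw u w .tw))}
  | .swcc c c' => (univ : Finset (WV m × WV m)).image fun uw => Sum.inr (.vand L (.swu c c' uw.1 uw.2))
  | .xcp i j c c' => {Sum.inr (.vand L (.pCol i c)), Sum.inr (.vand L (.pCol j c')), Sum.inr (.vand L (.swcc c c'))}
  | .xc i j => (univ : Finset (Fin (wn m) × Fin (wn m))).image fun cc => Sum.inr (.vand L (.xcp i j cc.1 cc.2))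
  | .pX i j => {Sum.inr (.vand L (.nsame i j)), Sum.inr (.vand L (.xc i j))}
  | .pAdj i j => {Sum.inr (.vand L (.pOwn i j)), Sum.inr (.vand L (.pX i j))}

/-! ### The output gates of a value -/

/-- The pasted value wire of bit `b` of label `L`. [folklore] -/
def awW (L : FLab m) (b : Fin (NB (wn m))) : Wire m :=
  match bdec b with
  | .inl (i, c) => Sum.inr (.vand L (.pCol i c))
  | .inr (i, j) => Sum.inr (.vand L (.pAdj i j))

/-- Kinds of the output gates of a value. [folklore] -/
def vlKind : VlGate m → Kind
  | .ndead => .nor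
  | .decOK => .and
  | .a1 => .and
  | .a2 => .and
  | .okk => .or
  | .ok => .and
  | .b1 _ => .and
  | .b2 _ => .and
  | .bb _ => .or
  | .bit _ => .and

/-- Sources of the output gates of the value of label `L`. [folklore] -/
def vlSrcs (L : FLab m) : VlGate m → Finset (Wire m)
  | .ndead => {deadW L (kF m)}
  | .decOK => {Sum.inr (.an L (kF m) .stop), Sum.inr (.vl L .ndead)}
  | .a1 => {Sum.inr (.an L (kF m) .isAND), Sum.inr (.vand L .andOk)}
  | .a2 => {Sum.inr (.an L (kF m) .nisAND), Sum.inr (.vor L .orOk)}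
  | .okk => {Sum.inr (.vl L .a1), Sum.inr (.vl L .a2)}
  | .ok => if (lU L).card = 1 then {Sum.inr (.vl L .decOK)} else {Sum.inr (.vl L .decOK), Sum.inr (.vl L .okk)}
  | .b1 b => {Sum.inr (.an L (kF m) .isAND), Sum.inr (.vand L .andOk), awW L b}
  | .b2 b => {Sum.inr (.an L (kF m) .nisAND), Sum.inr (.vor L (.orBit b))}
  | .bb b => {Sum.inr (.vl L (.b1 b)), Sum.inr (.vl L (.b2 b))}
  | .bit b =>
      if (lU L).card = 1 then
        insert (Sum.inr (.vl L .decOK))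
          (match bdec b with
            | .inl (i, c) => if (i : ℕ) = 0 then (lU L).image fun u => valW L (kF m) u c else {Sum.inr .ff}
            | .inr _ => {Sum.inr .ff})
      else {Sum.inr (.vl L .decOK), Sum.inr (.vl L (.bb b))}

/-! ### Root label and window positions, for the output gates -/

/-- A window vertex witnesses that the window is non-empty. -/
theorem wn_pos (u : WV m) : 0 < wn m := Finset.card_pos.2 ⟨u.1, u.2⟩

/-- The root label, given a window vertex. [folklore] -/
noncomputable def rootLabOf (u : WV m) : FLab m := rootLab m (wn_pos u)

/-- The row played by the index `a` (its rank among the window indices; junk outside the window), given a window vertex. [folklore] -/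
def wposW (u : WV m) (a : Fin m) : Fin (wn m) :=
  if ha : a ∈ windowSet m then GraphReadout.wpos (windowSet m) rfl a ha else ⟨0, wn_pos u⟩

end WCanon

end Summit.PneNP.PneNP.Theorems
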